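import Mathlib.Dynamics.BirkhoffSum.Average
import Mathlib.MeasureTheory.Integral.Bochner.Basic
import Mathlib.MeasureTheory.Measure.Typeclasses.Probability
import Mathlib.MeasureTheory.Constructions.BorelSpace.Basic
import Mathlib.Topology.MetricSpace.Basic
import Mathlib.Order.LiminfLimsup
import HarnessLib

/-!
# Ergodic optimisation: the maximum ergodic average and its time-average characterisation
# (named fact)

Topic `Literature/Dynamics/Ergodic` (Mathlib precedent `Mathlib/Dynamics/BirkhoffSum/…`; Mathlib has
`birkhoffSum T f n x = ∑_{i<n} f (T^[i] x)` but nothing on invariant measures of continuous maps of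
compact metric spaces as a weak-* compact set, maximizing measures, or ergodic optimisation —
`lean search 'Jenkinson|ergodic optimi|maximizing measure|Krylov.?Bogol'` gives 0 relevant hits,
2026-08-15). O. Jenkinson, *Ergodic optimization in dynamical systems*, Ergodic Theory Dynam.
Systems 39 (2019) 2593–2618 (`Jenkinson2018`, doi:10.1017/etds.2017.142 = arXiv:1712.02307; read in
the held copy, §2 p. 4):

> "Let `𝔇` denote the set of pairs `(X, T)` where `X = (X, d)` is a compact metric space and
> `T : X → X` is continuous. For `(X, T) ∈ 𝔇`, the set `𝓜_T` of `T`-invariant Borel probability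
> measures is compact when equipped with the weak* topology. Let `ℭ` denote the set of triples
> `(X, T, f)`, where `(X, T) ∈ 𝔇` and `f : X → ℝ` is continuous.
> **Definition 2.1.** For `(X, T, f) ∈ ℭ`, the quantity `β(f) = max_{μ ∈ 𝓜_T} ∫ f dμ` is the
> *maximum ergodic average*. Any `m ∈ 𝓜_T` satisfying `∫ f dm = β(f)` is an *`f`-maximizing measure*.
> **Proposition 2.2.** For `(X, T, f) ∈ ℭ`, the maximum ergodic average `β(f)` satisfies
> `β(f) = sup_{x ∈ X_{T,f}} lim_{n} (1/n) Sₙf(x) = sup_{x ∈ X} limsup_{n} (1/n) Sₙf(x)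
>       = limsup_{n→∞} (1/n) sup_{x ∈ X} Sₙf(x)`, where `Sₙf = ∑_{i=0}^{n-1} f ∘ Tⁱ`.
> **Proposition 2.3.** If `(X, T, f) ∈ ℭ` then: (i) There exists at least one `f`-maximizing
> measure."

The fact below vendors Def. 2.1 + Prop. 2.3 (i) (a maximizing invariant probability measure `m`
exists) together with the THIRD equality of Prop. 2.2
(`∫ f dm = limsup_{n} (1/n) sup_{x} Sₙf(x)`), on the carriers Mathlib has: `X` a nonempty compact
metric space with its Borel σ-algebra (`[MeasurableSpace X] [BorelSpace X]`; Jenkinson's `X ∈ 𝔇` is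
tacitly nonempty, otherwise `𝓜_T = ∅` and `max` is undefined), invariance as `Measure.map T m = m`
for the (continuous, hence Borel measurable) `T`, `Sₙf = birkhoffSum T f n`, `sup_{x ∈ X}` as the
real `iSup` (the supremum of a continuous function on a nonempty compact space, attained), and
`limsup` as `Filter.limsup … atTop` (the sequence is bounded by `‖f‖_∞`, so no junk value arises; the
`n = 0` term `0 / 0 = 0` is immaterial to a `limsup`). The first two equalities of Prop. 2.2 (pointwise
time averages) are NOT vendored.

Consumer: route `NavierStokesRegularity/TypeICertificateLadder`, support item
`ErgodicOptimisationDuality` (`stmt-NavierStokesRegularity-2885`: if every invariant probability has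
`∫ F dμ < β` then some continuous `g` has `F + g ∘ Φ − g < β` pointwise) — from this fact:
`∫ F dm < β` forces `(1/n) sup_x SₙF(x) < β` for some `n ≥ 1`, and `g := (1/n) ∑_{j<n} SⱼF` gives
`F + g∘Φ − g = (1/n) SₙF` (Jenkinson's proof device; the abstract half of the card's "completeness by
ergodic-optimisation duality", Tobasco–Goluskin–Doering 2018 for flows).

## References

* O. Jenkinson, *Ergodic optimization in dynamical systems*, Ergodic Theory Dynam. Systems 39 (2019),
  Def. 2.1, Prop. 2.2, Prop. 2.3 (i). [Jenkinson2018]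
* I. Tobasco, D. Goluskin, C. R. Doering, *Optimal bounds and extremal trajectories for time averages
  in nonlinear dynamical systems*, Phys. Lett. A 382 (2018). [TobascoGoluskinDoering2018]
-/

noncomputable section

open MeasureTheory Filter Topology

namespace Literature.Dynamics.Ergodic

universe u

/-- **Maximum ergodic average: existence of a maximizing measure and the time-average formula**
(Jenkinson 2018, Def. 2.1 "`β(f) = max_{μ ∈ 𝓜_T} ∫ f dμ`", Prop. 2.3 (i) "There exists at least one
`f`-maximizing measure", Prop. 2.2, third equality "`β(f) = limsup_{n→∞} (1/n) sup_{x ∈ X} Sₙf(x)`",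
`Sₙf = ∑_{i=0}^{n-1} f ∘ Tⁱ`). For a continuous self-map `T` of a nonempty compact metric space `X`
and a continuous `f : X → ℝ` there is a `T`-invariant Borel probability measure `m` with
`∫ f dμ ≤ ∫ f dm` for every `T`-invariant Borel probability measure `μ`, and
`∫ f dm = limsup_{n} (1/n) sup_{x} (birkhoffSum T f n x)`. Grounds
`Summit.NavierStokesRegularity.NavierStokesRegularity.Theses.TypeICertificateLadder.ErgodicOptimisationDuality`.
Not in Mathlib (no weak-* compactness of `𝓜_T` / Krylov–Bogolyubov there); stated as a `Prop`.
[cite: Jenkinson2018, Def. 2.1, Prop. 2.2 (third equality) and Prop. 2.3 (i)] -/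
def jenkinson_maxErgodicAverage : Prop :=
  ∀ (X : Type u) [MetricSpace X] [CompactSpace X] [Nonempty X] [MeasurableSpace X] [BorelSpace X]
    (T : X → X), Continuous T → ∀ (f : X → ℝ), Continuous f →
    ∃ m : Measure X, IsProbabilityMeasure m ∧ Measure.map T m = m ∧
      (∀ μ : Measure X, IsProbabilityMeasure μ → Measure.map T μ = μ →
        ∫ x, f x ∂μ ≤ ∫ x, f x ∂m) ∧
      Filter.limsup (fun n : ℕ => (⨆ x : X, birkhoffSum T f n x) / (n : ℝ)) Filter.atTop =
        ∫ x, f x ∂m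

end Literature.Dynamics.Ergodic
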